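import Summits.HubbardSuperconductivity.HubbardSuperconductivity.Theses.ThermalWedge
import Summits.HubbardSuperconductivity.HubbardSuperconductivity.Theses.TorusCooperLog
import Summits.HubbardSuperconductivity.HubbardSuperconductivity.Theorems.ThermalWedgeTwTipContinuationCrossRoute
import Summits.HubbardSuperconductivity.HubbardSuperconductivity.Theorems.ChiralWindowCwThesisChannelInfNonpos
import Summits.HubbardSuperconductivity.HubbardSuperconductivity.Theorems.ChiralWindowCwThesisHalfFilling
import Summits.HubbardSuperconductivity.HubbardSuperconductivity.Theorems.ChiralWindowDefsResidual
import Summits.HubbardSuperconductivity.HubbardSuperconductivity.Theorems.ChiralWindowCwKLChiralWindowBlockBoundsR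
import Summits.HubbardSuperconductivity.HubbardSuperconductivity.Theorems.ChiralWindowCwKLChiralWindowWindowBridge
import Summits.HubbardSuperconductivity.HubbardSuperconductivity.Theorems.ChiralWindowCwKLChiralWindowReductionL2
import Summits.HubbardSuperconductivity.HubbardSuperconductivity.Theorems.ChiralWindowCwKLChiralWindowMeanZero
import Summits.HubbardSuperconductivity.HubbardSuperconductivity.Theorems.ChiralWindowCwKLChiralWindowD4Invariant
import Summits.HubbardSuperconductivity.HubbardSuperconductivity.Theorems.ChiralWindowCwKLChiralWindowFiniteMeasure
import Summits.HubbardSuperconductivity.HubbardSuperconductivity.Theorems.ChiralWindowCwKLChiralWindowGradient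
import Summits.HubbardSuperconductivity.HubbardSuperconductivity.Theorems.ChiralWindowCwKLChiralWindowHausdorffFinite
import Summits.HubbardSuperconductivity.HubbardSuperconductivity.Theorems.ThermalWedgeTwTipContinuationB1gPointReduction
import Summits.HubbardSuperconductivity.HubbardSuperconductivity.Theorems.ThermalWedgeTwTipContinuationB1gFilling
import Summits.HubbardSuperconductivity.HubbardSuperconductivity.Theorems.ThermalWedgeTwTipContinuationB1gPointSound
import Summits.HubbardSuperconductivity.HubbardSuperconductivity.Theorems.ThermalWedgeTwTipContinuationB1gRecordDefs2
import HarnessLib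

/-!
# `TwTipContinuation` (stmt-HubbardSuperconductivity-1700) — line `kl-mechanism-datum`
# (crux-strategist pass p1, WALL-BREAKER): the SKELETON

Crux (route `ThermalWedge`, rank 6): `TwTipContinuation`.  Kernel-checked normal form (p85630
`twTipContinuation_iff_uniformSummitWindow`): the crux IS the `U`-uniform every-ground-state
`d_{x²-y²}` order window of the PURE torus at one doping `δ ∈ [1/10, 2/5]` (USW), and it alone implies
the summit.  Every line registered on it so far died at a single USW-class stub (isogap:
`stub_penaltyTransport`, p100643; moments: `stub_groundAverageOrder`; sharp sandwich:
`stub_thermalPenalty`, p107763) — see `Cruxes/TwTipContinuation/STRATEGY-CENSUS.md` (pass p1) §1–§2 for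
the diagnosis: the stubs of ANY line jointly give USW, and the only divisions with every stub strictly
below USW separate SCALES, whose open piece (condensation of an effectively attractive model) is the
hub's shared Kohn–Luttinger programme.

THIS LINE is the gate-enforced encoding of the strategist's decomposition D1 (MECHANISM + DATUM) as a
registered skeleton, filed because the formal `route edit --split` edge is refused to a non-final-cycle
seat (the prepared `children.json` is attached as evidence for the final cycle / tenure):

* `stub_klCanonical` — the MECHANISM: word for word the body of `TorusCooperLog.KLCanonical`
  (stmt-HubbardSuperconductivity-2681; `stub_klCanonical_iff` below records the identity by `Iff.rfl`).
  LEAD: this stub IS the shared research item 2681, staffed through route `TorusCooperLog`'s own crux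
  chain (round-1 ideas filed 2026-08-16) — do NOT attack it inside this crux; hold it nominally and
  end `blocked-on: stmt-HubbardSuperconductivity-2681` (or promote-stub → dedup) once the datum wave returns.
* `stub_b1gLeadsInWindow` — the DATUM, reduced to LEADERSHIP ONLY: at some `δ ∈ [1/10,2/5]` the `B₁g`
  channel bottom of the Kohn–Luttinger form lies strictly (by `γU²`) below every other `D₄` channel for
  all small `U`.  The attractiveness clause `channelInf B1g ≤ -γU²` of the usual two-clause datum
  (`TorusCooperLog.CertB1g` stmt-2682 / moot stmt-15257) is DISCHARGED in-file
  (`certB1gWedge_of_leads`) from the landed `CwThesis.stub_channelInfNonpos` (every channel bottom is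
  `≤ 0` on the band) and `CwThesis.chemicalPotentialOfDensity_doping_mem_Ioo`; so the certificate to be
  built (interval arithmetic: finite-rank Galerkin reduction of `U + U²χ₀(k+k')` on
  `L²(Fermi curve, dσ/|∇ε|)` per irrep + tail bound, cf. the `CwKLChiralWindow` certificate engine
  `Cruxes/CwKLChiralWindow/CertEngine.md` and `Theorems/ChiralWindowCwKLChiralWindow*`) has ONE family of
  inequalities to certify.  Any in-window leadership certificate closes it.  NB (checked 2026-08-17 in
  `Cruxes/CwKLChiralWindow/CertTarget.md`): the record being certified for `ChiralWindow.CwKLChiralWindow`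
  (stmt-1741) sits at the B1g/E crossing `n ≈ 0.5876`, i.e. `δ ≈ 0.412 > 2/5`, just OUTSIDE this window — its clause (i)
  does not close this stub, but its ENGINE (`KLCert` records, kernel `check` by `decide`, enclosures E0–E6, soundness
  `cwKLChiralWindow_of_klCertRS`) and μ-window lemmas (`δ ∈ [3/10,12/25]`) cover `δ ∈ [3/10, 2/5]`, where the B1g
  margins are 1–2 orders larger than at the crossing.  Recommended target: ONE point-box leadership record at `δ = 7/20`.

Composition (sorry-free): `certB1gWedge_of_leads` turns stub 2 into the two-clause in-window datum,
and the landed door `CrossRoute.twTipContinuation_of_klCanonical` (p92871, pure logic over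
`CwThesis.stub_penaltyResponseLRO` = `TorusCooperLog.PenaltyResponseLRO`, stmt-10879) concludes the crux
BY NAME: `twTipContinuation_of_stubs : «stub 1» → «stub 2» → TwTipContinuation`,
`TwTipContinuation_of : TwTipContinuation`.

Disproof.lean (gen 3 v2.1) honoured: entry through the corner (§1/§5/§11: the seeded RUNG is idle —
neither stub mentions the seeded family); §14 (`corner_summary`): the mechanism stub is the fixed-`κ`
intensive penalty response, i.e. form (a) with the every-GS layer (b) deleted by energies
(`PenaltyResponseLRO`), not an abstract Tip-shape (§8/§13 `AbstractTipShapeFalse`,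
`UniformRungsShapeFalse` are not instances); p90964 (`not_uniformOrderWindow`): `κ, c, γU²` are all
`U`-dependent; twist ceiling: the penalty `(κ/L⁴)Δ_dᴴΔ_d` is intensive.
Kohn–Luttinger 1965; Raghu–Kivelson–Scalapino PRB 81 (2010) 224505 §III (B₁g window at `t' = 0`,
non-rigorous). [folklore]

SKELETON v2 (lead c5, 2026-08-17): stub 2 RESHAPED into the point-stubs (R) `stub_b1gPointReduction`,
(F) `stub_b1gFilling`, (S) `stub_b1gPointSound` (all provable now, waved) and (C) `stub_b1gRecord` (the certified
computation at `μ₀ = -7/10`); `stub_b1gLeadsInWindow` keeps its registered statement but is now DERIVED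
(`b1gLeadsInWindow_of_pointStubs`).  Stubs of this skeleton: `stub_klCanonical` (held, = stmt-2681), (R), (F), (S), (C).
v2.1/v2.2: (R) p138028, (F) p138479, (S) p138724 LANDED and imported; open: `stub_klCanonical` (held) and (C) `stub_b1gRecord`.
v4: the concrete record `klB1gBox`/`klB1gTab`/`klB1gGamma` LANDED as definitions with its nine kernel-decided checks
(`Theorems/ThermalWedgeTwTipContinuationB1gRecordDefs.lean`); (C) is DERIVED; the one open numerical stub is (E) `stub_b1gEnclosures`.
Stubs of v4: `stub_klCanonical` (held, = stmt-2681), `stub_b1gEnclosures` (certified computation).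
v5: `stub_b1gEnclosures` re-pointed at the conservative record no. 2 (`klB1gBox2`, farm `N = 128` design, square-mass widths doubled after the
observed `N = 64 → 128` drifts; both records' claims hold on both tables — `Cruxes/TwTipContinuation/B1gRecordDesign.md` §4).
(A v3 variant with the `E` block in `E_x`-far form — stubs `stub_b1gChannelFarX`/`stub_b1gPointSoundX`/`stub_b1gRecordX`,
file `work/TwTipContinuation_v3_farx.lean` of the lead's folder — was registered 03:0xZ and WITHDRAWN the same hour: the
corrected float census (finite-`T` fallback on the cells the rigorous engine declines) shows the plain far bound suffices at
`μ₀ = -7/10`: `√H_E(deflated) ≈ 0.046 ≪ |Λ₁(B1g)| ≈ 0.097`.)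
-/

noncomputable section

set_option linter.dupNamespace false

namespace Summit.HubbardSuperconductivity.HubbardSuperconductivity.Cruxes.TwTipContinuation.KlMechanismDatum

open MeasureTheory Literature.MathematicalPhysics.QuantumLattice
open Summit.HubbardSuperconductivity.HubbardSuperconductivity.Theorems
open Summit.HubbardSuperconductivity.HubbardSuperconductivity.Theorems.CwKLChiralWindow
open Summit.HubbardSuperconductivity.HubbardSuperconductivity.Theses.ThermalWedge (TwTipContinuation)
open scoped Matrix ComplexOrder

/-! ### Stub 1 — the MECHANISM (≡ stmt-HubbardSuperconductivity-2681 `TorusCooperLog.KLCanonical`) -/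

/-- **Stub 1 (XL / open problem; = stmt-2681 verbatim, see `stub_klCanonical_iff`).**  Kohn–Luttinger
universality in CANONICAL pair-penalty form: for every `δ ∈ (0,1/2)`, IF the second-order pairing vertex
`U + U²χ₀(k+k')` on the `t'=0` Fermi curve at density `1-δ` has `B₁g` attractive (`≤ -γU²`) and
strictly leading every other `D₄` channel by `γU²` for all small `U`, THEN `∃U₀ ∀U∈(0,U₀) ∃κ,c>0`:
eventually along `L = 2(k+1)`, `c·κ ≤ E_L(U;κ) − E_L(U;0)`, where
`E_L(U;κ) = minEnergyOn (hubbardTorus 2 L 1 U + (κ/L⁴)Δ_dᴴΔ_d) (szSector N_L 0)`, `N_L = 2⌊(1−δ)L²/2⌋`.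
Staffed via route `TorusCooperLog`; not to be attacked inside this crux (see the module docstring).
Arovas–Berg–Kivelson–Raghu, Ann. Rev. CMP 13 (2022) §1 item 1, §9 (open). [folklore] -/
theorem stub_klCanonical :
    ∀ δ ∈ Set.Ioo (0:ℝ) (1 / 2), (∃ γ U₁ : ℝ, 0 < γ ∧ 0 < U₁ ∧ ∀ U ∈ Set.Ioo (0:ℝ) U₁, Literature.MathematicalPhysics.QuantumLattice.channelInf (Literature.MathematicalPhysics.QuantumLattice.squareDispersion 1 0) (Literature.MathematicalPhysics.QuantumLattice.chemicalPotentialOfDensity (Literature.MathematicalPhysics.QuantumLattice.squareDispersion 1 0) (1 - δ)) U Literature.MathematicalPhysics.QuantumLattice.D4Irrep.B1g ≤ -(γ * U ^ 2) ∧ ∀ χ : Literature.MathematicalPhysics.QuantumLattice.D4Irrep, χ ≠ Literature.MathematicalPhysics.QuantumLattice.D4Irrep.B1g → Literature.MathematicalPhysics.QuantumLattice.channelInf (Literature.MathematicalPhysics.QuantumLattice.squareDispersion 1 0) (Literature.MathematicalPhysics.QuantumLattice.chemicalPotentialOfDensity (Literature.MathematicalPhysics.QuantumLattice.squareDispersion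 1 0) (1 - δ)) U Literature.MathematicalPhysics.QuantumLattice.D4Irrep.B1g + γ * U ^ 2 ≤ Literature.MathematicalPhysics.QuantumLattice.channelInf (Literature.MathematicalPhysics.QuantumLattice.squareDispersion 1 0) (Literature.MathematicalPhysics.QuantumLattice.chemicalPotentialOfDensity (Literature.MathematicalPhysics.QuantumLattice.squareDispersion 1 0) (1 - δ)) U χ) → ∃ U₀ : ℝ, 0 < U₀ ∧ ∀ U ∈ Set.Ioo (0:ℝ) U₀, ∃ κ : ℝ, 0 < κ ∧ ∃ c : ℝ, 0 < c ∧ ∀ᶠ k : ℕ in Filter.atTop, c * κ ≤ Matrix.minEnergyOn (Literature.MathematicalPhysics.QuantumLattice.hubbardTorus 2 (2 * (k + 1)) 1 U + ((κ / ((2 * (k + 1) : ℕ) : ℝ) ^ 4 : ℝ) : ℂ) • ((Literature.MathematicalPhysics.QuantumLattice.pairField Literature.MathematicalPhysics.QuantumLattice.dWaveFormFactor (2 * (k + 1)))ᴴ * Literature.MathematicalPhysics.QuantumLattice.pairField Literature.MathematicalPhysics.QuantumLattice.dWaveFormFactor (2 * (k + 1)))) (Literature.MathematicalPhysics.QuantumLattice.szSector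 (2 * ⌊(1 - δ) * ((2 * (k + 1) : ℕ) : ℝ) ^ 2 / 2⌋₊) 0) - Matrix.minEnergyOn (Literature.MathematicalPhysics.QuantumLattice.hubbardTorus 2 (2 * (k + 1)) 1 U) (Literature.MathematicalPhysics.QuantumLattice.szSector (2 * ⌊(1 - δ) * ((2 * (k + 1) : ℕ) : ℝ) ^ 2 / 2⌋₊) 0) := by
  sorry

/-- Record: stub 1 IS `TorusCooperLog.KLCanonical` (stmt-2681), definitionally. [folklore] -/
theorem stub_klCanonical_iff :
    (∀ δ ∈ Set.Ioo (0:ℝ) (1 / 2), (∃ γ U₁ : ℝ, 0 < γ ∧ 0 < U₁ ∧ ∀ U ∈ Set.Ioo (0:ℝ) U₁, Literature.MathematicalPhysics.QuantumLattice.channelInf (Literature.MathematicalPhysics.QuantumLattice.squareDispersion 1 0) (Literature.MathematicalPhysics.QuantumLattice.chemicalPotentialOfDensity (Literature.MathematicalPhysics.QuantumLattice.squareDispersion 1 0) (1 - δ)) U Literature.MathematicalPhysics.QuantumLattice.D4Irrep.B1g ≤ -(γ * U ^ 2) ∧ ∀ χ : Literature.MathematicalPhysics.QuantumLattice.D4Irrep,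 χ ≠ Literature.MathematicalPhysics.QuantumLattice.D4Irrep.B1g → Literature.MathematicalPhysics.QuantumLattice.channelInf (Literature.MathematicalPhysics.QuantumLattice.squareDispersion 1 0) (Literature.MathematicalPhysics.QuantumLattice.chemicalPotentialOfDensity (Literature.MathematicalPhysics.QuantumLattice.squareDispersion 1 0) (1 - δ)) U Literature.MathematicalPhysics.QuantumLattice.D4Irrep.B1g + γ * U ^ 2 ≤ Literature.MathematicalPhysics.QuantumLattice.channelInf (Literature.MathematicalPhysics.QuantumLattice.squareDispersion 1 0) (Literature.MathematicalPhysics.QuantumLattice.chemicalPotentialOfDensity (Literature.MathematicalPhysics.QuantumLattice.squareDispersion 1 0) (1 - δ)) U χ) → ∃ U₀ : ℝ, 0 < U₀ ∧ ∀ U ∈ Set.Ioo (0:ℝ) U₀, ∃ κ : ℝ, 0 < κ ∧ ∃ c : ℝ, 0 < c ∧ ∀ᶠ k : ℕ in Filter.atTop, c * κ ≤ Matrix.minEnergyOn (Literature.MathematicalPhysics.QuantumLattice.hubbardTorus 2 (2 * (k + 1)) 1 U + ((κ / ((2 * (k + 1) : ℕ) : ℝ) ^ 4 : ℝ) : ℂ)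 • ((Literature.MathematicalPhysics.QuantumLattice.pairField Literature.MathematicalPhysics.QuantumLattice.dWaveFormFactor (2 * (k + 1)))ᴴ * Literature.MathematicalPhysics.QuantumLattice.pairField Literature.MathematicalPhysics.QuantumLattice.dWaveFormFactor (2 * (k + 1)))) (Literature.MathematicalPhysics.QuantumLattice.szSector (2 * ⌊(1 - δ) * ((2 * (k + 1) : ℕ) : ℝ) ^ 2 / 2⌋₊) 0) - Matrix.minEnergyOn (Literature.MathematicalPhysics.QuantumLattice.hubbardTorus 2 (2 * (k + 1)) 1 U) (Literature.MathematicalPhysics.QuantumLattice.szSector (2 * ⌊(1 - δ) * ((2 * (k + 1) : ℕ) : ℝ) ^ 2 / 2⌋₊) 0)) ↔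
    Summit.HubbardSuperconductivity.HubbardSuperconductivity.Theses.TorusCooperLog.KLCanonical :=
  Iff.rfl

/-! ### Stub 2 — the DATUM, leadership only — RESHAPED (lead c5, skeleton v2) into four point-stubs

The registered statement `stub_b1gLeadsInWindow` (below, now DERIVED, no `sorry` of its own) is reduced to a
ONE-POINT certificate at a rational chemical potential `μ₀ ∈ (-4,0)` with `n(μ₀) ∈ [3/5, 9/10]`
(chosen `μ₀ = -7/10`, `n(μ₀) ≈ 0.70`, `δ ≈ 0.30` — deep inside the `d_{x²-y²}` region of every `U → 0` map,
cf. Disproof.lean §Literature, and inside `[1/10, 2/5]`):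

* `stub_b1gPointReduction` (R, provable now): `U = 1` leadership by `γ` at `μ₀` + the two filling inequalities ⟹
  the registered statement with `δ := 1 - n(μ₀)` (`kl_wb_chemicalPotential_one_sub_one_sub`), `U₁ := 1`, margin `γU²`
  (`U²`-homogeneity off `A1g`: `kl_rl_channelInf_sq_of_meanZero` + `stub_klMeanZero`/`stub_klFiniteMeasure`/
  `stub_klD4Invariant`/`stub_klGradient`/`stub_klHausdorffFinite`; bare-`U` penalty for `A1g`: `kl_rl_sq_channelInf_one_le`);
* `stub_b1gFilling` (F, provable now): `3/5 ≤ n(-7/10) ≤ 9/10` (ball ⊂ occupied set ⊂ ball, pattern of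
  `Theorems/ChiralWindowCwKLChiralWindowMuWindow.lean`);
* `stub_b1gPointSound` (S, provable now): soundness of a ONE-BOX `B₁g`-leads certificate over the LANDED vocabulary of crux
  stmt-1741 (`KLBox`, `KLBlock.EnclosureR/templeOKR/lowerOKR/lowerR/upper`, `KLBox.b1gLeadsOKR`; `stub_klBlockBoundsR`) — no
  new definition; it is clause N1 of `stub_klCertNumericalRS` cut out of the window certificate;
* `stub_b1gRecord` (C, the certified computation): a concrete box `bx` at `mulo = -7/10`, a table of trigonometric trials /
  deflation vectors and a margin `γ > 0` passing the seven Boolean checks (by `decide` on the literal) AND the residual-form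
  enclosures `(bx.blk χ).EnclosureR tab μ₀ χ` of the five channels at the ONE level `μ₀` (interval arithmetic; float design
  data: kit jobs j021803/j021805 + `work/num` of the lead's folder) — the residual numerical hypothesis of this line.
-/

/-- **(R) Point reduction — LANDED p138028** (`Theorems/ThermalWedgeTwTipContinuationB1gPointReduction.lean`).  `U = 1` leadership of `B₁g` by `γ > 0` at a level `μ₀ ∈ (-4,0)` whose free-band
filling lies in `[3/5, 9/10]` gives the in-window datum: `δ := 1 - n(μ₀) ∈ [1/10, 2/5]`, `μ(1-δ) = μ₀`
(`kl_wb_chemicalPotential_one_sub_one_sub`), and for `U ∈ (0,1)` the bottoms scale as `U²` off `A1g`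
(`kl_rl_channelInf_sq_of_meanZero`, mean zero by `stub_klMeanZero`) while `U² Λ₁(A1g) ≤ Λ_U(A1g)`
(`kl_rl_sq_channelInf_one_le`); cf. clause (i) of `cwKLChiralWindow_of_certificate`.
[cite: RaghuKivelsonScalapino2010, §II (7) and (13)] -/
theorem stub_b1gPointReduction :
    ∀ μ₀ γ : ℝ, -4 < μ₀ → μ₀ < 0 → 0 < γ →
    3 / 5 ≤ KohnLuttinger.filling (squareDispersion 1 0) μ₀ →
    KohnLuttinger.filling (squareDispersion 1 0) μ₀ ≤ 9 / 10 →
    (∀ χ : D4Irrep, χ ≠ D4Irrep.B1g →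
      channelInf (squareDispersion 1 0) μ₀ 1 D4Irrep.B1g + γ ≤ channelInf (squareDispersion 1 0) μ₀ 1 χ) →
    ∃ δ ∈ Set.Icc (1 / 10 : ℝ) (2 / 5), ∃ γ U₁ : ℝ, 0 < γ ∧ 0 < U₁ ∧ ∀ U ∈ Set.Ioo (0:ℝ) U₁,
      ∀ χ : D4Irrep, χ ≠ D4Irrep.B1g →
        channelInf (squareDispersion 1 0) (chemicalPotentialOfDensity (squareDispersion 1 0) (1 - δ)) U
            D4Irrep.B1g + γ * U ^ 2 ≤
          channelInf (squareDispersion 1 0) (chemicalPotentialOfDensity (squareDispersion 1 0) (1 - δ)) U χ :=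
  Summit.HubbardSuperconductivity.TwTipContinuation.KlMechanismDatum.stub_b1gPointReduction

/-- **(F) The filling at `μ₀ = -7/10` — LANDED p138479** (`Theorems/ThermalWedgeTwTipContinuationB1gFilling.lean`, kernel-checked `cos` enclosures of the tree's fixed-point engine `FI`).  `3/5 ≤ n(-7/10) ≤ 9/10` for the free band
`ε₀ = -2(cos k₀ + cos k₁)`: the occupied set `{cos k₀ + cos k₁ > 7/20}` contains the disc of radius `1.96`
(`2cos(1.96/√2) > 7/20`, convexity of `t ↦ cos √t`) and is contained in the disc of radius `2.29`
(`1 + cos 2.29 < 7/20`), whence `n = 2·area/(2π)² ∈ [1.96²/(2π), 2.29²/(2π)] ⊂ [0.61, 0.84]`; pattern of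
`kl_mu_ball_subset_occupied` / `kl_mu_occupied_subset_ball` in `Theorems/ChiralWindowCwKLChiralWindowMuWindow.lean`. [folklore] -/
theorem stub_b1gFilling :
    3 / 5 ≤ KohnLuttinger.filling (squareDispersion 1 0) (-7 / 10) ∧
      KohnLuttinger.filling (squareDispersion 1 0) (-7 / 10) ≤ 9 / 10 :=
  Summit.HubbardSuperconductivity.TwTipContinuation.KlMechanismDatum.stub_b1gFilling

/-- **(S) Soundness of the one-box `B₁g`-leads certificate — LANDED p138724** (`Theorems/ThermalWedgeTwTipContinuationB1gPointSound.lean`, no new definition).  For a box `bx`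
of the landed record vocabulary read AT ITS LEFT END `μ = bx.mulo ∈ (-4,0)`: if the `B₁g` block passes the
residual-form Temple test (`templeOKR`, which contains the Ritz data) without the bare-`U` term, the four other
blocks have certified lower bounds (`lowerOKR`), the rational comparison `bB1g.upper + γ ≤ bχ.lowerR` holds for the
four competitors (`b1gLeadsOKR`), and the residual-form enclosures of the five blocks hold at `μ`, then
`Λ₁(μ,B1g) + γ ≤ Λ₁(μ,χ)` for every `χ ≠ B1g` — by `stub_klBlockBoundsR` (`lowerR ≤ channelInf`, `channelInf B1g ≤ upper`),
exactly clause N1 of `stub_klCertNumericalRS`. [cite: ReedSimonIV1978, Thm. XIII.5] -/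
theorem stub_b1gPointSound :
    ∀ (bx : KLBox) (tab : List KLTrig) (γ : ℚ),
    -4 < bx.mulo → bx.mulo < 0 →
    bx.bB1g.templeOKR tab D4Irrep.B1g = true → bx.bB1g.withU = false →
    bx.bA1g.lowerOKR tab D4Irrep.A1g = true → bx.bA2g.lowerOKR tab D4Irrep.A2g = true →
    bx.bB2g.lowerOKR tab D4Irrep.B2g = true → bx.bE.lowerOKR tab D4Irrep.E = true →
    bx.b1gLeadsOKR tab γ = true →
    (∀ χ : D4Irrep, (bx.blk χ).EnclosureR tab ((bx.mulo : ℚ) : ℝ) χ) →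
    ∀ χ : D4Irrep, χ ≠ D4Irrep.B1g →
      channelInf (squareDispersion 1 0) ((bx.mulo : ℚ) : ℝ) 1 D4Irrep.B1g + ((γ : ℚ) : ℝ) ≤
        channelInf (squareDispersion 1 0) ((bx.mulo : ℚ) : ℝ) 1 χ :=
  Summit.HubbardSuperconductivity.TwTipContinuation.KlMechanismDatum.stub_b1gPointSound

/-- **(E) THE RESIDUAL NUMERICAL HYPOTHESIS OF THE LINE (skeleton v4): the eight residual-form enclosures of the `B₁g`-point
record at `μ₀ = -7/10`.**  For the concrete CONSERVATIVE record `klB1gBox2`/`klB1gTab2` (`Theorems/…B1gRecordDefs2.lean`, `N = 128`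
design with doubled square-mass widths; the first record `klB1gBox`, p139888, stays in the tree with its own assembly p139987): `Nlo ≤ ∫Φ² dσ ≤ Nhi`,
`Qlo ≤ ∫∫ Φ χ₀ Φ ≤ Qhi`, `∫(F_Φ - sΦ)² ≤ Thi`, `∫∫ K_B1g² ≤ Hhi` for the `B₁g` trial `Φ = klB1gTab[0]`, and the deflated sector square
masses `∫∫ (K_χ - D_χ)² ≤ Hhi_χ` for `A₁g` (one deflation vector), `A₂g`, `B₂g` (none), `E` (top doublet, quarter-turn pair) —
interval arithmetic at ONE chemical potential (certification targets and the float design census: `Cruxes/TwTipContinuation/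
B1gRecordDesign.md`).  Not provable in a session; the ccert-class computation debt of this line. [folklore] -/
theorem stub_b1gEnclosures :
    ∀ χ : D4Irrep, (Summit.HubbardSuperconductivity.TwTipContinuation.KlMechanismDatum.klB1gBox2.blk χ).EnclosureR
      Summit.HubbardSuperconductivity.TwTipContinuation.KlMechanismDatum.klB1gTab2
      ((Summit.HubbardSuperconductivity.TwTipContinuation.KlMechanismDatum.klB1gBox2.mulo : ℚ) : ℝ) χ := by
  sorry

/-- **(C) The certified record at `μ₀ = -7/10` — now DERIVED** from the concrete record no. 2 (nine kernel-decided checks `klB1g2_*`,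
`Theorems/…B1gRecordDefs2.lean`) and the residual numerical hypothesis (E). [cite: RaghuKivelsonScalapino2010, §III Fig. 2] -/
theorem stub_b1gRecord :
    ∃ (bx : KLBox) (tab : List KLTrig) (γ : ℚ), 0 < γ ∧ bx.mulo = -7 / 10 ∧
    bx.bB1g.templeOKR tab D4Irrep.B1g = true ∧ bx.bB1g.withU = false ∧
    bx.bA1g.lowerOKR tab D4Irrep.A1g = true ∧ bx.bA2g.lowerOKR tab D4Irrep.A2g = true ∧
    bx.bB2g.lowerOKR tab D4Irrep.B2g = true ∧ bx.bE.lowerOKR tab D4Irrep.E = true ∧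
    bx.b1gLeadsOKR tab γ = true ∧
    (∀ χ : D4Irrep, (bx.blk χ).EnclosureR tab ((bx.mulo : ℚ) : ℝ) χ) :=
  open Summit.HubbardSuperconductivity.TwTipContinuation.KlMechanismDatum in
  ⟨klB1gBox2, klB1gTab2, klB1gGamma2, klB1g2_gamma_pos, klB1g2_mulo, klB1g2_templeOKR, klB1g2_withU, klB1g2_lowerOKR_A1g,
    klB1g2_lowerOKR_A2g, klB1g2_lowerOKR_B2g, klB1g2_lowerOKR_E, klB1g2_b1gLeadsOKR, stub_b1gEnclosures⟩

/-- **Composition of the four point-stubs into the registered stub-2 statement** (sorry-free). [folklore] -/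
theorem b1gLeadsInWindow_of_pointStubs :
    ∃ δ ∈ Set.Icc (1 / 10 : ℝ) (2 / 5), ∃ γ U₁ : ℝ, 0 < γ ∧ 0 < U₁ ∧ ∀ U ∈ Set.Ioo (0:ℝ) U₁,
      ∀ χ : D4Irrep, χ ≠ D4Irrep.B1g →
        channelInf (squareDispersion 1 0) (chemicalPotentialOfDensity (squareDispersion 1 0) (1 - δ)) U
            D4Irrep.B1g + γ * U ^ 2 ≤
          channelInf (squareDispersion 1 0) (chemicalPotentialOfDensity (squareDispersion 1 0) (1 - δ)) U χ := by
  obtain ⟨bx, tab, γ, hγ, hμ, h1, h2, h3, h4, h5, h6, h7, hE⟩ := stub_b1gRecord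
  have hlead := stub_b1gPointSound bx tab γ (by rw [hμ]; norm_num) (by rw [hμ]; norm_num) h1 h2 h3 h4 h5 h6 h7 hE
  have hμR : ((bx.mulo : ℚ) : ℝ) = -7 / 10 := by rw [hμ]; push_cast; ring
  rw [hμR] at hlead
  exact stub_b1gPointReduction (-7 / 10) γ (by norm_num) (by norm_num) (by exact_mod_cast hγ)
    stub_b1gFilling.1 stub_b1gFilling.2 hlead

/-- **Stub 2 (registered name, now DERIVED from (R)+(F)+(S)+(C)).**  At some doping `δ ∈ [1/10, 2/5]` the `B₁g`
channel bottom of the Kohn–Luttinger pairing form on the `t' = 0` Fermi curve at density `1-δ` lies below every other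
`D₄` channel bottom by a margin `γU²`, for all `U ∈ (0,U₁)`.  Raghu–Kivelson–Scalapino, PRB 81 (2010) 224505 §III.
[cite: RaghuKivelsonScalapino2010, §III Fig. 2] -/
theorem stub_b1gLeadsInWindow :
    ∃ δ ∈ Set.Icc (1 / 10 : ℝ) (2 / 5), ∃ γ U₁ : ℝ, 0 < γ ∧ 0 < U₁ ∧ ∀ U ∈ Set.Ioo (0:ℝ) U₁,
      ∀ χ : D4Irrep, χ ≠ D4Irrep.B1g →
        channelInf (squareDispersion 1 0) (chemicalPotentialOfDensity (squareDispersion 1 0) (1 - δ)) U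
            D4Irrep.B1g + γ * U ^ 2 ≤
          channelInf (squareDispersion 1 0) (chemicalPotentialOfDensity (squareDispersion 1 0) (1 - δ)) U χ :=
  b1gLeadsInWindow_of_pointStubs

/-! ### Glue (sorry-free) -/

/-- **Leadership in the window gives the two-clause in-window datum** (the moot item stmt-15257 /
window form of `TorusCooperLog.CertB1g`): attractiveness `channelInf B1g ≤ -γU²` follows from
leadership over `A₂g` and the landed non-positivity of every channel bottom on the band
(`CwThesis.stub_channelInfNonpos`, with `μ(1-δ) ∈ (-4,0)` from
`CwThesis.chemicalPotentialOfDensity_doping_mem_Ioo`). [folklore] -/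
theorem certB1gWedge_of_leads
    (h : ∃ δ ∈ Set.Icc (1 / 10 : ℝ) (2 / 5), ∃ γ U₁ : ℝ, 0 < γ ∧ 0 < U₁ ∧ ∀ U ∈ Set.Ioo (0:ℝ) U₁,
      ∀ χ : D4Irrep, χ ≠ D4Irrep.B1g →
        channelInf (squareDispersion 1 0) (chemicalPotentialOfDensity (squareDispersion 1 0) (1 - δ)) U
            D4Irrep.B1g + γ * U ^ 2 ≤
          channelInf (squareDispersion 1 0) (chemicalPotentialOfDensity (squareDispersion 1 0) (1 - δ)) U χ) :
    ∃ δ ∈ Set.Icc (1 / 10 : ℝ) (2 / 5), ∃ γ U₁ : ℝ, 0 < γ ∧ 0 < U₁ ∧ ∀ U ∈ Set.Ioo (0:ℝ) U₁, Literature.MathematicalPhysics.QuantumLattice.channelInf (Literature.MathematicalPhysics.QuantumLattice.squareDispersion 1 0) (Literature.MathematicalPhysics.QuantumLattice.chemicalPotentialOfDensity (Literature.MathematicalPhysics.QuantumLattice.squareDispersion 1 0) (1 - δ)) U Literature.MathematicalPhysics.QuantumLattice.D4Irrep.B1g ≤ -(γ * U ^ 2) ∧ ∀ χ : Literature.MathematicalPhysics.QuantumLattice.D4Irrep,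 χ ≠ Literature.MathematicalPhysics.QuantumLattice.D4Irrep.B1g → Literature.MathematicalPhysics.QuantumLattice.channelInf (Literature.MathematicalPhysics.QuantumLattice.squareDispersion 1 0) (Literature.MathematicalPhysics.QuantumLattice.chemicalPotentialOfDensity (Literature.MathematicalPhysics.QuantumLattice.squareDispersion 1 0) (1 - δ)) U Literature.MathematicalPhysics.QuantumLattice.D4Irrep.B1g + γ * U ^ 2 ≤ Literature.MathematicalPhysics.QuantumLattice.channelInf (Literature.MathematicalPhysics.QuantumLattice.squareDispersion 1 0) (Literature.MathematicalPhysics.QuantumLattice.chemicalPotentialOfDensity (Literature.MathematicalPhysics.QuantumLattice.squareDispersion 1 0) (1 - δ)) U χ := by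
  obtain ⟨δ, hδ, γ, U₁, hγ, hU₁, hlead⟩ := h
  refine ⟨δ, hδ, γ, U₁, hγ, hU₁, fun U hU => ⟨?_, hlead U hU⟩⟩
  have hδ' : δ ∈ Set.Ioo (0 : ℝ) 1 := ⟨by linarith [hδ.1], by linarith [hδ.2]⟩
  have hμ := Summit.HubbardSuperconductivity.HubbardSuperconductivity.Theorems.CwThesis.chemicalPotentialOfDensity_doping_mem_Ioo hδ'
  have hA2g : D4Irrep.A2g ≠ D4Irrep.B1g := by decide
  have h1 := hlead U hU D4Irrep.A2g hA2g
  have h2 := Summit.HubbardSuperconductivity.HubbardSuperconductivity.Theorems.CwThesis.stub_channelInfNonpos U D4Irrep.A2g hμ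
  linarith

/-- **Composition: stub 1 → stub 2 → the crux, BY NAME** — through `certB1gWedge_of_leads` and the
landed door `CrossRoute.twTipContinuation_of_klCanonical` (p92871). [folklore] -/
theorem twTipContinuation_of_stubs
    (h₁ : ∀ δ ∈ Set.Ioo (0:ℝ) (1 / 2), (∃ γ U₁ : ℝ, 0 < γ ∧ 0 < U₁ ∧ ∀ U ∈ Set.Ioo (0:ℝ) U₁, Literature.MathematicalPhysics.QuantumLattice.channelInf (Literature.MathematicalPhysics.QuantumLattice.squareDispersion 1 0) (Literature.MathematicalPhysics.QuantumLattice.chemicalPotentialOfDensity (Literature.MathematicalPhysics.QuantumLattice.squareDispersion 1 0) (1 - δ)) U Literature.MathematicalPhysics.QuantumLattice.D4Irrep.B1g ≤ -(γ * U ^ 2) ∧ ∀ χ : Literature.MathematicalPhysics.QuantumLattice.D4Irrep, χ ≠ Literature.MathematicalPhysics.QuantumLattice.D4Irrep.B1g → Literature.MathematicalPhysics.QuantumLattice.channelInf (Literature.MathematicalPhysics.QuantumLattice.squareDispersion 1 0) (Literature.MathematicalPhysics.QuantumLattice.chemicalPotentialOfDensity (Literature.MathematicalPhysics.QuantumLattice.squareDispersion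 1 0) (1 - δ)) U Literature.MathematicalPhysics.QuantumLattice.D4Irrep.B1g + γ * U ^ 2 ≤ Literature.MathematicalPhysics.QuantumLattice.channelInf (Literature.MathematicalPhysics.QuantumLattice.squareDispersion 1 0) (Literature.MathematicalPhysics.QuantumLattice.chemicalPotentialOfDensity (Literature.MathematicalPhysics.QuantumLattice.squareDispersion 1 0) (1 - δ)) U χ) → ∃ U₀ : ℝ, 0 < U₀ ∧ ∀ U ∈ Set.Ioo (0:ℝ) U₀, ∃ κ : ℝ, 0 < κ ∧ ∃ c : ℝ, 0 < c ∧ ∀ᶠ k : ℕ in Filter.atTop, c * κ ≤ Matrix.minEnergyOn (Literature.MathematicalPhysics.QuantumLattice.hubbardTorus 2 (2 * (k + 1)) 1 U + ((κ / ((2 * (k + 1) : ℕ) : ℝ) ^ 4 : ℝ) : ℂ) • ((Literature.MathematicalPhysics.QuantumLattice.pairField Literature.MathematicalPhysics.QuantumLattice.dWaveFormFactor (2 * (k + 1)))ᴴ * Literature.MathematicalPhysics.QuantumLattice.pairField Literature.MathematicalPhysics.QuantumLattice.dWaveFormFactor (2 * (k + 1)))) (Literature.MathematicalPhysics.QuantumLattice.szSector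 (2 * ⌊(1 - δ) * ((2 * (k + 1) : ℕ) : ℝ) ^ 2 / 2⌋₊) 0) - Matrix.minEnergyOn (Literature.MathematicalPhysics.QuantumLattice.hubbardTorus 2 (2 * (k + 1)) 1 U) (Literature.MathematicalPhysics.QuantumLattice.szSector (2 * ⌊(1 - δ) * ((2 * (k + 1) : ℕ) : ℝ) ^ 2 / 2⌋₊) 0))
    (h₂ : ∃ δ ∈ Set.Icc (1 / 10 : ℝ) (2 / 5), ∃ γ U₁ : ℝ, 0 < γ ∧ 0 < U₁ ∧ ∀ U ∈ Set.Ioo (0:ℝ) U₁,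
      ∀ χ : D4Irrep, χ ≠ D4Irrep.B1g →
        channelInf (squareDispersion 1 0) (chemicalPotentialOfDensity (squareDispersion 1 0) (1 - δ)) U
            D4Irrep.B1g + γ * U ^ 2 ≤
          channelInf (squareDispersion 1 0) (chemicalPotentialOfDensity (squareDispersion 1 0) (1 - δ)) U χ) :
    TwTipContinuation :=
  Summit.HubbardSuperconductivity.TwTipContinuation.CrossRoute.twTipContinuation_of_klCanonical h₁
    (certB1gWedge_of_leads h₂)

/-- **The line concludes the crux** `ThermalWedge.TwTipContinuation` from its two registered stubs.
[folklore] -/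
theorem TwTipContinuation_of : TwTipContinuation :=
  twTipContinuation_of_stubs stub_klCanonical stub_b1gLeadsInWindow

end Summit.HubbardSuperconductivity.HubbardSuperconductivity.Cruxes.TwTipContinuation.KlMechanismDatum

end
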